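import Literature.NumberTheory.Automorphic.Liu2021.Def411WeilCarriersLocalDataAtV
import Literature.NumberTheory.Automorphic.UnitaryGroupDualPairCarriers
import Literature.RepresentationTheory.HeisenbergGroup.ImplementerTransport
import HarnessLib

/-!
# The line-model transport `(a•T_V, δ) ≅ (T_V, δ/a)` of local Weil data for the rank-one unitary dual pair `(U(V), U(W_a))`

Topic `NumberTheory/GelbartRogawski1991`; namespace `Literature.NumberTheory.GelbartRogawski1991.UnitaryDualPair.LocalSplitting`.
KERNEL mathematics only: definitions with bodies + theorems; no named fact, no `sorry`.  Cell hodgecm-mathlib (D-0151),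
the MODEL TRANSPORT booked by the director (INBOX 02:10:27Z / 02:22:42Z) for the `hD3` line a4-liuD3 (B-plan1's slot
`stub_modelTransport`); it is the bridge between

* the FAMILY currency of `HypD3` = `Def411WeilCarriers.localIndexedFamilyAtV … 3 e₁ JV hcδ hδ hd … aOf χOf 𝓢Of …`
  (Def411WeilCarriersLocalDataAtV.lean §5, `e₁ = Equiv.prodUnique (Fin 3) (Fin 1)`): member `a = aOf t` carries the
  local Weil representation `((𝓢Of t).omegaLoc v).comp (localLineInl E c N e₁ JV (JW F E a) v)` of `U(J_V)(F_v)`, i.e. a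
  section `s′` into the metaplectic group `LocalMp F N (gram F e₁ T_V (T_W a)) v` of the PAIR Gram matrix
  `reindex e₁ e₁ (T_V ⊗ₖ (a)) = a•T_V` with the trace-zero element `δ` FIXED; and
* the δ-MODEL currency of rows IV-4c1/IV-4c2/IV-4c3 (`rankOne_theta_lines_disjoint`, `rankOne_thetaChar_eq_of_areIsomorphicRep`,
  `rankOne_theta_twist_rigidity`): ONE metaplectic group `LocalMp F N T_V v`, sections over `iota … hcδ′ hδ′ hd′ T_V …` for
  VARYING `δ′`.

THE TRANSPORT (at the reindexing `Equiv.prodUnique (Fin N) (Fin 1)`, so that `𝒮(F_vⁿ) = 𝒮(F_vᴺ)`): the linear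
automorphism `e′_a : (x, y) ↦ (x, a•y)` of `𝕎_v = F_vᴺ × F_vᴺ` (`lineScale`) is an ISOMETRY `polar β_{a•T_V} → polar β_{T_V}`
(`⟨x, T_V (a y′)⟩ = ⟨x, (aT_V) y′⟩`, `polar_localPairing_lineScale`), under which the Schrödinger models agree ON THE NOSE on
the same space `𝒮(F_vᴺ)`: `ρ_{a•T_V} = ρ_{T_V} ∘ H(e′_a)` (`localSchrodinger_gramLine_eq`).  Hence (tree `ImplementerTransport`,
same-space case, `implements_iff_implements_symplecticConj`) the SAME operator `M` of `𝒮(F_vᴺ)` implements `e′_a g e′_a⁻¹` in the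
model `β_{T_V}` iff it implements `g` in the model `β_{a•T_V}`; and `e′_a` carries the embedding of `U(J_V)(F_v)` for `(a•T_V, δ)`
(through `k ↦ k ⊗ 1`) to the embedding for `(T_V, δ/a)`: in the coordinates `u = x + δ y = x + (δ/a)(a y)` one has
`reIm_{δ/a} = e′_a ∘ reIm_δ` (`symplecticConj_lineScale_iota_localLineInl`).  CONSEQUENCE (`lineTransportSection`,
`exists_lineTransportSection`): every section `s′` over `ι^{a•T_V}_δ` yields the section `s(g) := (ι^{T_V}_{δ/a}(g), M(s′(g ⊗ 1)))`
over `ι^{T_V}_{δ/a}` into the COMMON `LocalMp F N T_V v` whose Weil representation `ω_s` IS `ω_{s′} ∘ localLineInl` — an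
EQUALITY of representations of `U(J_V)(F_v)` on `𝒮(F_vᴺ)` (`omega_lineTransportSection`), so smoothness
(`isSmooth_lineTransportSection`), the `χ`-coinvariants `Θ_s(χ)`, their non-vanishing and `AreIsomorphicRep` statements
transfer by rewriting.  (Kernel hygiene: the operator `M(s′(g ⊗ 1))` is introduced as `lineTransportOp` through `Classical.choose` on its defining
equation `lineTransportOp_def`, so that no definitional unfolding ever has to compare the two models' types.)  Step-1 representatives: `a · eps (δ/a) = δ ⊗ 1` while the family's `epsLine a = a · (δ ⊗ 1)`; they
differ by the NORM `a² = a·aᶜ`, so the class conditions agree (`sameClass_epsLine_iff_sameClass_eps_lineDelta`).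

References: [MoeglinVignerasWaldspurger1987] Chap. 2 I.4, II.1 (A)–(B) (the metaplectic group of pairs and its
functoriality in the symplectic datum); [Weil1964] n° 5, n° 34 («changement de base»); [GelbartRogawski1991] §3.1
p. 454 (`W = Res_{E/F}(V ⊗ W)`); [Liu2021] App. D §D.1 Step 1 (the classes of `ε ∈ E^{−×}/Nm E^×`).
-/

set_option autoImplicit false

noncomputable section

open scoped Matrix Kronecker
open NumberField IsDedekindDomain
open Literature.RepresentationTheory.HeisenbergGroup
open Literature.NumberTheory.Automorphic Literature.NumberTheory.Automorphic.UnitaryGroup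
open Literature.NumberTheory.Automorphic.Liu2021 (LemD1OfPlace.eps)
open Literature.NumberTheory.Automorphic.Liu2021.Def411WeilCarriers (TW JW JW_eq isSymm_TW epsLine coe_epsLine)

namespace Literature.NumberTheory.GelbartRogawski1991.UnitaryDualPair.LocalSplitting

variable (F E : Type) [Field F] [NumberField F] [Field E] [NumberField E] [Algebra F E]
  [Algebra.IsQuadraticExtension F E] (c : E ≃ₐ[F] E) (N : ℕ)
  {δ : E} (hcδ : c δ = -δ) (hδ : δ ≠ 0) {d : F} (hd : δ * δ = algebraMap F E d)
  (TV : Matrix (Fin N) (Fin N) F) (hV : TV.IsSymm) (JV : Matrix (Fin N) (Fin N) E) (hJV : JV = TV.map (algebraMap F E))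
  (a : Fˣ) (v : HeightOneSpectrum (𝓞 F))

/-! ## §1 The second line's trace-zero element `δ/a` -/

section Delta

variable {F E c}

omit [NumberField F] [NumberField E] [Algebra.IsQuadraticExtension F E] in
include hcδ in
/-- `c (a⁻¹δ) = -(a⁻¹δ)` (`c` is `F`-linear). [cite: Liu2021, App. D §D.1 Step 1 (l. 5217)] -/
theorem conj_lineDelta : c (algebraMap F E (↑a⁻¹ : F) * δ) = -(algebraMap F E (↑a⁻¹ : F) * δ) := by
  rw [map_mul, AlgEquiv.commutes, hcδ, mul_neg]

omit [NumberField F] [NumberField E] [Algebra.IsQuadraticExtension F E] in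
include hδ in
/-- `a⁻¹δ ≠ 0`. [cite: Liu2021, App. D §D.1 Step 1 (l. 5217)] -/
theorem lineDelta_ne_zero : algebraMap F E (↑a⁻¹ : F) * δ ≠ 0 :=
  mul_ne_zero ((map_ne_zero (algebraMap F E)).2 (a⁻¹).ne_zero) hδ

omit [NumberField F] [NumberField E] [Algebra.IsQuadraticExtension F E] in
include hd in
/-- `(a⁻¹δ)² = a⁻² d ∈ F`. [cite: Liu2021, App. D §D.1 Step 1 (l. 5217)] -/
theorem lineDelta_mul_self :
    algebraMap F E (↑a⁻¹ : F) * δ * (algebraMap F E (↑a⁻¹ : F) * δ) = algebraMap F E (↑a⁻¹ * ↑a⁻¹ * d) := by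
  rw [map_mul, map_mul, ← hd]; ring

end Delta

/-! ## §2 The pair Gram matrix at `Equiv.prodUnique` is `a • T_V`; the pairings `β_{a•T_V}(x, y) = β_{T_V}(x, a•y)` -/

section Gram

/-- `𝕋(gram (T_V, (a))) = a • 𝕋(T_V)` in `M_N(F_v)` (`reindex (T_V ⊗ₖ (a))` has entries `T_{ij}·a`).
[cite: GelbartRogawski1991, §3.1 p. 454] -/
theorem localGram_gramLine :
    localGram F N (gram F (Equiv.prodUnique (Fin N) (Fin 1)) TV (TW F a)) v =
      algebraMap F (v.adicCompletion F) (a : F) • localGram F N TV v := by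
  refine Matrix.ext fun i j => ?_
  change algebraMap F (v.adicCompletion F)
      ((TV ⊗ₖ TW F a) ((Equiv.prodUnique (Fin N) (Fin 1)).symm i) ((Equiv.prodUnique (Fin N) (Fin 1)).symm j)) =
    algebraMap F (v.adicCompletion F) (a : F) * algebraMap F (v.adicCompletion F) (TV i j)
  have hTW : ∀ i' j' : Fin 1, TW F a i' j' = (a : F) := fun i' j' => by
    rw [Subsingleton.elim i' 0, Subsingleton.elim j' 0]; rfl
  rw [Equiv.prodUnique_symm_apply, Equiv.prodUnique_symm_apply, Matrix.kroneckerMap_apply, map_mul, hTW, mul_comm]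

/-- `β_{gram (T_V,(a))} = a • β_{T_V}` as bilinear maps. [cite: Weil1964, n° 34, p. 182] -/
theorem localPairing_gramLine_eq :
    localPairing F N (gram F (Equiv.prodUnique (Fin N) (Fin 1)) TV (TW F a)) v =
      algebraMap F (v.adicCompletion F) (a : F) • localPairing F N TV v := by
  change Matrix.toLinearMap₂' (v.adicCompletion F) (localGram F N (gram F (Equiv.prodUnique (Fin N) (Fin 1)) TV (TW F a)) v) = _
  rw [localGram_gramLine, map_smul]

/-- **`β_{a•T_V}(x, y) = β_{T_V}(x, a•y)`**. [cite: Weil1964, n° 34, p. 182] -/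
theorem localPairing_gramLine (x y : Fin N → v.adicCompletion F) :
    localPairing F N (gram F (Equiv.prodUnique (Fin N) (Fin 1)) TV (TW F a)) v x y =
      localPairing F N TV v x (algebraMap F (v.adicCompletion F) (a : F) • y) := by
  rw [localPairing_gramLine_eq, LinearMap.smul_apply, LinearMap.smul_apply, LinearMap.map_smul]

end Gram

/-! ## §3 The isometry `e′_a : (x, y) ↦ (x, a•y)` and the equality of Schrödinger models -/

section Scale

variable {F N v}

/-- **`e′_t : (x, y) ↦ (x, t•y)`**, a linear automorphism of `𝕎_v = F_vᴺ × F_vᴺ` for a unit `t` of `F_v`.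
[cite: Weil1964, n° 34, p. 182] -/
def lineScale (t : (v.adicCompletion F)ˣ) :
    ((Fin N → v.adicCompletion F) × (Fin N → v.adicCompletion F)) ≃ₗ[v.adicCompletion F]
      ((Fin N → v.adicCompletion F) × (Fin N → v.adicCompletion F)) where
  toFun w := (w.1, (t : v.adicCompletion F) • w.2)
  invFun w := (w.1, ((t⁻¹ : (v.adicCompletion F)ˣ) : v.adicCompletion F) • w.2)
  map_add' w w' := Prod.ext rfl (smul_add _ _ _)
  map_smul' r w := Prod.ext rfl (smul_comm (t : v.adicCompletion F) r w.2)
  left_inv w := Prod.ext rfl (by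
    change ((t⁻¹ : (v.adicCompletion F)ˣ) : v.adicCompletion F) • (t : v.adicCompletion F) • w.2 = w.2
    rw [smul_smul, Units.inv_mul, one_smul])
  right_inv w := Prod.ext rfl (by
    change (t : v.adicCompletion F) • ((t⁻¹ : (v.adicCompletion F)ˣ) : v.adicCompletion F) • w.2 = w.2
    rw [smul_smul, Units.mul_inv, one_smul])

/-- formula. [cite: Weil1964, n° 34, p. 182] -/
@[simp] theorem lineScale_apply (t : (v.adicCompletion F)ˣ) (w : (Fin N → v.adicCompletion F) × (Fin N → v.adicCompletion F)) :
    lineScale t w = (w.1, (t : v.adicCompletion F) • w.2) := rfl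

/-- formula for the inverse. [cite: Weil1964, n° 34, p. 182] -/
@[simp] theorem lineScale_symm_apply (t : (v.adicCompletion F)ˣ)
    (w : (Fin N → v.adicCompletion F) × (Fin N → v.adicCompletion F)) :
    (lineScale t).symm w = (w.1, ((t⁻¹ : (v.adicCompletion F)ˣ) : v.adicCompletion F) • w.2) := rfl

variable (F v)

/-- the unit `a ⊗ 1 ∈ F_vˣ` of `a ∈ Fˣ` (as `Units.mk0`, so that `↑(unitAt a) = a ⊗ 1` and `↑(unitAt a)⁻¹ = (a ⊗ 1)⁻¹`
definitionally). [folklore] -/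
abbrev unitAt : (v.adicCompletion F)ˣ :=
  Units.mk0 (algebraMap F (v.adicCompletion F) (a : F)) ((map_ne_zero _).2 a.ne_zero)

variable (N)

/-- **`e′_a` is an isometry `polar β_{a•T_V} → polar β_{T_V}`**: `β_{T_V}((e′_a p).1, (e′_a q).2) = β_{a•T_V}(p.1, q.2)`.
[cite: Weil1964, n° 5, p. 150; n° 34, p. 182] -/
theorem polar_localPairing_lineScale (p q : (Fin N → v.adicCompletion F) × (Fin N → v.adicCompletion F)) :
    polar (localPairing F N TV v) (lineScale (unitAt F a v) p) (lineScale (unitAt F a v) q) =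
      polar (localPairing F N (gram F (Equiv.prodUnique (Fin N) (Fin 1)) TV (TW F a)) v) p q := by
  rw [polar_apply, polar_apply, lineScale_apply, lineScale_apply, localPairing_gramLine]
  rfl

/-- **`ρ_{a•T_V} = ρ_{T_V} ∘ H(e′_a)` on `𝒮(F_vᴺ)`**: the Schrödinger operator of `((x, y), t)` for the duality `β_{a•T_V}`
is the Schrödinger operator of `((x, a•y), t)` for `β_{T_V}` — the same formula `Φ ↦ ψ(t + ⟨u, T_V(a y)⟩) Φ(u + x)`.
[cite: MoeglinVignerasWaldspurger1987, Chap. 2 I.4 Exemple (1); Weil1964, n° 34, p. 182] -/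
theorem localSchrodinger_gramLine_eq
    (h : Heisenberg (polar (localPairing F N (gram F (Equiv.prodUnique (Fin N) (Fin 1)) TV (TW F a)) v))) :
    localSchrodinger F N (gram F (Equiv.prodUnique (Fin N) (Fin 1)) TV (TW F a)) v h =
      localSchrodinger F N TV v (Heisenberg.mapEquiv (lineScale (unitAt F a v)) (polar_localPairing_lineScale F N TV a v) h) := by
  refine LinearMap.ext fun f => Subtype.ext (funext fun u => ?_)
  change ((schrodingerSB _ _ _ _ h f : SchwartzBruhat _) : _ → ℂ) u =
    ((schrodingerSB _ _ _ _ _ f : SchwartzBruhat _) : _ → ℂ) u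
  rw [schrodingerSB_apply, schrodingerSB_apply, Heisenberg.mapEquiv_t, Heisenberg.mapEquiv_v, lineScale_apply,
    localPairing_gramLine]
  rfl

end Scale

/-! ## §4 The transport of implementers: `M` implements `e′_a g e′_a⁻¹` for `ρ_{T_V}` iff it implements `g` for `ρ_{a•T_V}` -/

section Transport

/-- **Same-space transport of implementers** (tree `implements_iff_implements_symplecticConj` at `ρ_{a•T_V} = ρ_{T_V} ∘ H(e′_a)`):
for `(g, M) ∈ S̃p_ψ(𝕎_v, β_{a•T_V})`, the SAME operator `M` implements `e′_a g e′_a⁻¹` for the Schrödinger model of `β_{T_V}`.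
[cite: MoeglinVignerasWaldspurger1987, Chap. 2 II.1 (A)–(B); Weil1964, n° 34, p. 182] -/
theorem implements_symplecticConj_lineScale (m : LocalMp F N (gram F (Equiv.prodUnique (Fin N) (Fin 1)) TV (TW F a)) v) :
    Implements (localSchrodinger F N TV v)
      (ofSymplectic _ (symplecticConj (lineScale (unitAt F a v)) (polar_localPairing_lineScale F N TV a v) m.1.1)) m.1.2 :=
  (implements_iff_implements_symplecticConj (lineScale (unitAt F a v)) (polar_localPairing_lineScale F N TV a v)
    (localSchrodinger_gramLine_eq F N TV a v) _ _).1 ((mem_MpPsi _ _).1 m.2)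

end Transport

/-! ## §5 Quadratic coordinates: `reIm_{δ/a} = e′_a ∘ reIm_δ`, and `k ⊗ 1 = k` at `Equiv.prodUnique` -/

section Coordinates

/-- the two coordinate systems `E_v = F_v ⊕ F_v δ = F_v ⊕ F_v (δ/a)`: `Ψ_{δ/a}(p, q) = Ψ_δ(p, a⁻¹q)`.
[cite: GelbartRogawski1991, §3.1 p. 454] -/
theorem quadraticLocalEquiv_lineDelta (p q : v.adicCompletion F) :
    quadraticLocalEquiv E v c (conj_lineDelta hcδ a) (lineDelta_ne_zero hδ a) (p, q) =
      quadraticLocalEquiv E v c hcδ hδ (p, (algebraMap F (v.adicCompletion F) (a : F))⁻¹ * q) := by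
  rw [quadraticLocalEquiv_apply, quadraticLocalEquiv_apply]
  dsimp only
  rw [map_mul (algebraMap E (LocalRing E v)), map_mul (toLocalRing E v)]
  have h1 : algebraMap E (LocalRing E v) (algebraMap F E (↑a⁻¹ : F)) =
      toLocalRing E v ((algebraMap F (v.adicCompletion F) (a : F))⁻¹) := by
    rw [← map_inv₀, ← Units.val_inv_eq_inv_val]
    exact (toLocalRing_coe E v _).symm
  rw [h1]; ring

/-- **`reIm_{δ/a}⁻¹ = reIm_δ⁻¹ ∘ e′_a⁻¹`** on `F_vᴺ × F_vᴺ`. [cite: GelbartRogawski1991, §3.1 p. 454] -/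
theorem reIm_lineDelta_symm_apply (w : (Fin N → v.adicCompletion F) × (Fin N → v.adicCompletion F)) :
    (QuadraticCoordinates.reIm (quadraticLocalEquiv E v c (conj_lineDelta hcδ a) (lineDelta_ne_zero hδ a)).toLinearEquiv.toAddEquiv
        (Fin N)).symm w =
      (QuadraticCoordinates.reIm (quadraticLocalEquiv E v c hcδ hδ).toLinearEquiv.toAddEquiv (Fin N)).symm
        ((lineScale (unitAt F a v)).symm w) := by
  funext i
  exact quadraticLocalEquiv_lineDelta F E c hcδ hδ a v (w.1 i) (w.2 i)

/-- **`reIm_{δ/a} = e′_a ∘ reIm_δ`** on `E_vᴺ` (`u = x + δ y = x + (δ/a)(a y)`). [cite: GelbartRogawski1991, §3.1 p. 454] -/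
theorem reIm_lineDelta_apply (z : Fin N → LocalRing E v) :
    QuadraticCoordinates.reIm (quadraticLocalEquiv E v c (conj_lineDelta hcδ a) (lineDelta_ne_zero hδ a)).toLinearEquiv.toAddEquiv
        (Fin N) z =
      lineScale (unitAt F a v) (QuadraticCoordinates.reIm (quadraticLocalEquiv E v c hcδ hδ).toLinearEquiv.toAddEquiv (Fin N) z) := by
  apply (QuadraticCoordinates.reIm (quadraticLocalEquiv E v c (conj_lineDelta hcδ a)
    (lineDelta_ne_zero hδ a)).toLinearEquiv.toAddEquiv (Fin N)).symm.injective
  rw [AddEquiv.symm_apply_apply, reIm_lineDelta_symm_apply (hcδ := hcδ) (hδ := hδ), LinearEquiv.symm_apply_apply,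
    AddEquiv.symm_apply_apply]

omit [Algebra.IsQuadraticExtension F E] in
/-- **at the reindexing `Equiv.prodUnique`, `k ⊗ 1 = k`**: the matrix over `E_v = Π_w E_w` of `localLineInl k ∈ U(J_V ⊗ J_W)(F_v)`
(regrouped by `localPiEquiv`) is the matrix of `k ∈ U(J_V)(F_v)`. [cite: MoeglinVignerasWaldspurger1987, Chap. 1 I.17] -/
theorem coe_localPiEquiv_localLineInl_prodUnique (JW' : Matrix (Fin 1) (Fin 1) E) (k : localPi E c N JV v) :
    ((localPiEquiv E c N (Matrix.reindex (Equiv.prodUnique (Fin N) (Fin 1)) (Equiv.prodUnique (Fin N) (Fin 1)) (JV ⊗ₖ JW')) v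
          (localLineInl E c N (Equiv.prodUnique (Fin N) (Fin 1)) JV JW' v k) :
        «local» E c N (Matrix.reindex (Equiv.prodUnique (Fin N) (Fin 1)) (Equiv.prodUnique (Fin N) (Fin 1)) (JV ⊗ₖ JW')) v) :
        GL (Fin N) (LocalRing E v)) =
      ((localPiEquiv E c N JV v k : «local» E c N JV v) : GL (Fin N) (LocalRing E v)) := by
  rw [coe_localPiEquiv_apply, coe_localPiEquiv_apply]
  refine Units.ext (Matrix.ext fun i j => funext fun w => ?_)
  rw [GLn.coe_piEquiv_symm_apply, GLn.coe_piEquiv_symm_apply]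
  change ((localLineGL E N (Equiv.prodUnique (Fin N) (Fin 1)) v (k : LocalGLPi E N v) w : GL (Fin N) (w.1.adicCompletion E)) :
      Matrix (Fin N) (Fin N) (w.1.adicCompletion E)) i j = _
  rw [coe_localLineGL_apply, Matrix.reindex_apply, Matrix.submatrix_apply, Equiv.prodUnique_symm_apply,
    Equiv.prodUnique_symm_apply, Matrix.kroneckerMap_apply, Matrix.one_apply_eq, mul_one]

end Coordinates

/-! ## §6 The embeddings: `e′_a ∘ ι^{a•T_V}_δ(k ⊗ 1) ∘ e′_a⁻¹ = ι^{T_V}_{δ/a}(k)` -/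

section Iota

/-- **The transport carries `ι^{a•T_V}_δ ∘ (k ↦ k ⊗ 1)` to `ι^{T_V}_{δ/a}`**: for `k ∈ U(J_V)(F_v)`,
`e′_a ∘ ι_δ(k ⊗ 1) ∘ e′_a⁻¹ = ι_{δ/a}(k)` in `Sp(𝕎_v, β_{T_V})` — both are `u ↦ k u` on `E_vᴺ`, read in the coordinates
`(x, a y)` of `u = x + δ y = x + (δ/a)(a y)`. [cite: MoeglinVignerasWaldspurger1987, Ch. 1 I.17; GelbartRogawski1991, §3.1 p. 454] -/
theorem symplecticConj_lineScale_iota_localLineInl (k : localPi E c N JV v) :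
    symplecticConj (lineScale (unitAt F a v)) (polar_localPairing_lineScale F N TV a v)
        (iota F E c N hcδ hδ hd (gram F (Equiv.prodUnique (Fin N) (Fin 1)) TV (TW F a))
          (isSymm_gram F (Equiv.prodUnique (Fin N) (Fin 1)) hV (isSymm_TW F a))
          (reindex_kronecker_eq_gram_map F E (Equiv.prodUnique (Fin N) (Fin 1)) hJV (JW_eq F E a)) v
          (localLineInl E c N (Equiv.prodUnique (Fin N) (Fin 1)) JV (JW F E a) v k)) =
      iota F E c N (conj_lineDelta hcδ a) (lineDelta_ne_zero hδ a) (lineDelta_mul_self hd a) TV hV hJV v k := by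
  apply Subtype.ext
  refine LinearEquiv.ext fun w => ?_
  rw [symplecticConj_apply, iota_def, iota_def]
  change lineScale (unitAt F a v) ((localToSymplectic E c N v hcδ hδ hd
      (isSymm_gram F (Equiv.prodUnique (Fin N) (Fin 1)) hV (isSymm_TW F a))
      (reindex_kronecker_eq_gram_map F E (Equiv.prodUnique (Fin N) (Fin 1)) hJV (JW_eq F E a))
      (localPiEquiv E c N _ v (localLineInl E c N (Equiv.prodUnique (Fin N) (Fin 1)) JV (JW F E a) v k))).1
        ((lineScale (unitAt F a v)).symm w)) =
    (localToSymplectic E c N v (conj_lineDelta hcδ a) (lineDelta_ne_zero hδ a) (lineDelta_mul_self hd a) hV hJV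
      (localPiEquiv E c N JV v k)).1 w
  -- write `e′_a⁻¹ w = reIm_δ x` and `w = reIm_{δ/a} x` for the same `x ∈ E_vᴺ`
  set x := (QuadraticCoordinates.reIm (quadraticLocalEquiv E v c hcδ hδ).toLinearEquiv.toAddEquiv (Fin N)).symm
    ((lineScale (unitAt F a v)).symm w) with hx
  have hw₁ : (lineScale (unitAt F a v)).symm w =
      QuadraticCoordinates.reIm (quadraticLocalEquiv E v c hcδ hδ).toLinearEquiv.toAddEquiv (Fin N) x := by
    rw [hx, AddEquiv.apply_symm_apply]
  have hw₂ : w = QuadraticCoordinates.reIm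
      (quadraticLocalEquiv E v c (conj_lineDelta hcδ a) (lineDelta_ne_zero hδ a)).toLinearEquiv.toAddEquiv (Fin N) x := by
    rw [reIm_lineDelta_apply (hcδ := hcδ) (hδ := hδ), ← hw₁, LinearEquiv.apply_symm_apply]
  rw [hw₁, localToSymplectic_reIm, hw₂, localToSymplectic_reIm, reIm_lineDelta_apply (hcδ := hcδ) (hδ := hδ),
    coe_localPiEquiv_localLineInl_prodUnique]

end Iota

/-! ## §7 The transported section and its Weil representation -/

section Section

variable (s' : localPi E c N (Matrix.reindex (Equiv.prodUnique (Fin N) (Fin 1)) (Equiv.prodUnique (Fin N) (Fin 1)) (JV ⊗ₖ JW F E a)) v →*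
  LocalMp F N (gram F (Equiv.prodUnique (Fin N) (Fin 1)) TV (TW F a)) v)

omit [Algebra.IsQuadraticExtension F E] in
/-- (kernel hygiene) the operator `M(s′(g ⊗ 1))` of `𝒮(F_vᴺ)` exists with its defining equation — used to introduce it
through `Classical.choose`, so that no definitional unfolding can reach the pair model's types through it.
[cite: MoeglinVignerasWaldspurger1987, Chap. 2 II.1 (A)] -/
private theorem exists_eq_lineTransportOp (g : localPi E c N JV v) :
    ∃ M : SchwartzBruhat (Fin N → v.adicCompletion F) ≃ₗ[ℂ] SchwartzBruhat (Fin N → v.adicCompletion F),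
      M = (s' (localLineInl E c N (Equiv.prodUnique (Fin N) (Fin 1)) JV (JW F E a) v g)).1.2 :=
  ⟨_, rfl⟩

omit [Algebra.IsQuadraticExtension F E] in
/-- **the operator `M(s′(g ⊗ 1))` of `𝒮(F_vᴺ)`** attached to `g ∈ U(J_V)(F_v)` by the pair-model section `s′` (introduced through
`Classical.choose` on its defining equation, hence definitionally inert; unfold with `lineTransportOp_def`).
[cite: MoeglinVignerasWaldspurger1987, Chap. 2 II.1 (A)] -/
def lineTransportOp (g : localPi E c N JV v) :
    SchwartzBruhat (Fin N → v.adicCompletion F) ≃ₗ[ℂ] SchwartzBruhat (Fin N → v.adicCompletion F) :=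
  Classical.choose (exists_eq_lineTransportOp F E c N TV JV a v s' g)

omit [Algebra.IsQuadraticExtension F E] in
/-- unfolding equation of `lineTransportOp`: it is the operator component of `s′(g ⊗ 1)`.
[cite: MoeglinVignerasWaldspurger1987, Chap. 2 II.1 (A)] -/
theorem lineTransportOp_def (g : localPi E c N JV v) :
    lineTransportOp F E c N TV JV a v s' g = (s' (localLineInl E c N (Equiv.prodUnique (Fin N) (Fin 1)) JV (JW F E a) v g)).1.2 :=
  Classical.choose_spec (exists_eq_lineTransportOp F E c N TV JV a v s' g)

omit [Algebra.IsQuadraticExtension F E] in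
/-- `M(s′(g ⊗ 1)) = toOp (s′(g ⊗ 1))` (pair model). [cite: MoeglinVignerasWaldspurger1987, Chap. 2 II.1 (A)] -/
theorem toOp_pair_eq_lineTransportOp (g : localPi E c N JV v) :
    MpPsi.toOp _ (s' (localLineInl E c N (Equiv.prodUnique (Fin N) (Fin 1)) JV (JW F E a) v g)) =
      lineTransportOp F E c N TV JV a v s' g := by
  rw [lineTransportOp_def, MpPsi.toOp_apply]

/-- **The transported section** `s(g) := (ι^{T_V}_{δ/a}(g), M(s′(g ⊗ 1))) : U(J_V)(F_v) →* S̃p_ψ(𝕎_v, β_{T_V})` of a section `s′`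
over `ι^{a•T_V}_δ` of the pair model `(a•T_V, δ)`: the operator of `s′(g ⊗ 1)` implements `e′_a ι_δ(g ⊗ 1) e′_a⁻¹ = ι_{δ/a}(g)`.
[cite: MoeglinVignerasWaldspurger1987, Chap. 2 II.1; Chap. 3 I.1] -/
def lineTransportSection
    (hs' : ∀ g, MpPsi.proj _ (s' g) = iota F E c N hcδ hδ hd (gram F (Equiv.prodUnique (Fin N) (Fin 1)) TV (TW F a))
      (isSymm_gram F (Equiv.prodUnique (Fin N) (Fin 1)) hV (isSymm_TW F a))
      (reindex_kronecker_eq_gram_map F E (Equiv.prodUnique (Fin N) (Fin 1)) hJV (JW_eq F E a)) v g) :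
    localPi E c N JV v →* LocalMp F N TV v where
  toFun g := ⟨(iota F E c N (conj_lineDelta hcδ a) (lineDelta_ne_zero hδ a) (lineDelta_mul_self hd a) TV hV hJV v g,
      lineTransportOp F E c N TV JV a v s' g), by
    rw [mem_MpPsi]
    dsimp only
    have h := implements_symplecticConj_lineScale F N TV a v
      (s' (localLineInl E c N (Equiv.prodUnique (Fin N) (Fin 1)) JV (JW F E a) v g))
    have hproj : symplecticConj (lineScale (unitAt F a v)) (polar_localPairing_lineScale F N TV a v)
        (s' (localLineInl E c N (Equiv.prodUnique (Fin N) (Fin 1)) JV (JW F E a) v g)).1.1 =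
        iota F E c N (conj_lineDelta hcδ a) (lineDelta_ne_zero hδ a) (lineDelta_mul_self hd a) TV hV hJV v g := by
      have h1 := hs' (localLineInl E c N (Equiv.prodUnique (Fin N) (Fin 1)) JV (JW F E a) v g)
      rw [MpPsi.proj_apply] at h1
      rw [h1]
      exact symplecticConj_lineScale_iota_localLineInl F E c N hcδ hδ hd TV hV JV hJV a v g
    have hop : (s' (localLineInl E c N (Equiv.prodUnique (Fin N) (Fin 1)) JV (JW F E a) v g)).1.2 =
        lineTransportOp F E c N TV JV a v s' g :=
      (lineTransportOp_def F E c N TV JV a v s' g).symm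
    rw [hproj, hop] at h
    exact h⟩
  map_one' := Subtype.ext (Prod.ext (map_one _) (by
    change lineTransportOp F E c N TV JV a v s' 1 = 1
    rw [lineTransportOp_def, map_one, map_one]
    rfl))
  map_mul' g g' := Subtype.ext (Prod.ext (map_mul _ g g') (by
    change lineTransportOp F E c N TV JV a v s' (g * g') =
      lineTransportOp F E c N TV JV a v s' g * lineTransportOp F E c N TV JV a v s' g'
    rw [lineTransportOp_def, lineTransportOp_def, lineTransportOp_def, map_mul, map_mul]
    rfl))

variable (hs' : ∀ g, MpPsi.proj _ (s' g) = iota F E c N hcδ hδ hd (gram F (Equiv.prodUnique (Fin N) (Fin 1)) TV (TW F a))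
  (isSymm_gram F (Equiv.prodUnique (Fin N) (Fin 1)) hV (isSymm_TW F a))
  (reindex_kronecker_eq_gram_map F E (Equiv.prodUnique (Fin N) (Fin 1)) hJV (JW_eq F E a)) v g)

/-- **`s` is a section over `ι^{T_V}_{δ/a}`**. [cite: MoeglinVignerasWaldspurger1987, Chap. 2 II.1 (B); Ch. 1 I.17] -/
theorem proj_lineTransportSection (g : localPi E c N JV v) :
    MpPsi.proj _ (lineTransportSection F E c N hcδ hδ hd TV hV JV hJV a v s' hs' g) =
      iota F E c N (conj_lineDelta hcδ a) (lineDelta_ne_zero hδ a) (lineDelta_mul_self hd a) TV hV hJV v g := rfl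

/-- the operator of `s(g)` is `M(s′(g ⊗ 1))`. [cite: MoeglinVignerasWaldspurger1987, Chap. 2 II.1 (A)] -/
theorem toOp_lineTransportSection_eq_lineTransportOp (g : localPi E c N JV v) :
    MpPsi.toOp _ (lineTransportSection F E c N hcδ hδ hd TV hV JV hJV a v s' hs' g) =
      lineTransportOp F E c N TV JV a v s' g := rfl

/-- **the operators are unchanged**: `toOp (s g) = toOp (s′(g ⊗ 1))`. [cite: MoeglinVignerasWaldspurger1987, Chap. 2 II.1 (A)] -/
theorem toOp_lineTransportSection (g : localPi E c N JV v) :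
    MpPsi.toOp _ (lineTransportSection F E c N hcδ hδ hd TV hV JV hJV a v s' hs' g) =
      MpPsi.toOp _ (s' (localLineInl E c N (Equiv.prodUnique (Fin N) (Fin 1)) JV (JW F E a) v g)) :=
  (toOp_lineTransportSection_eq_lineTransportOp F E c N hcδ hδ hd TV hV JV hJV a v s' hs' g).trans
    (toOp_pair_eq_lineTransportOp F E c N TV JV a v s' g).symm

/-- **the Weil operators are unchanged**: `ω_s(g) = ω_{s′}(g ⊗ 1)` as operators of `𝒮(F_vᴺ)`.
[cite: MoeglinVignerasWaldspurger1987, Chap. 2 II.1 (A)] -/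
theorem toRep_lineTransportSection (g : localPi E c N JV v) :
    MpPsi.toRep _ (lineTransportSection F E c N hcδ hδ hd TV hV JV hJV a v s' hs' g) =
      MpPsi.toRep _ (s' (localLineInl E c N (Equiv.prodUnique (Fin N) (Fin 1)) JV (JW F E a) v g)) := by
  have h₁ : MpPsi.toRep _ (lineTransportSection F E c N hcδ hδ hd TV hV JV hJV a v s' hs' g) =
      LinearEquiv.automorphismGroup.toLinearMapMonoidHom
        (MpPsi.toOp _ (lineTransportSection F E c N hcδ hδ hd TV hV JV hJV a v s' hs' g)) := rfl
  have h₂ : MpPsi.toRep _ (s' (localLineInl E c N (Equiv.prodUnique (Fin N) (Fin 1)) JV (JW F E a) v g)) =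
      LinearEquiv.automorphismGroup.toLinearMapMonoidHom
        (MpPsi.toOp _ (s' (localLineInl E c N (Equiv.prodUnique (Fin N) (Fin 1)) JV (JW F E a) v g))) := rfl
  rw [h₁, h₂, toOp_lineTransportSection F E c N hcδ hδ hd TV hV JV hJV a v s' hs' g]

/-- **`ω_s = ω_{s′} ∘ (k ↦ k ⊗ 1)` as representations of `U(J_V)(F_v)` on `𝒮(F_vᴺ)`** — the family member's carrier
`(𝓢.omegaLoc v).comp (localLineInl …)` IS the δ-model carrier `(MpPsi.toRep (localSchrodinger F N T_V v)).comp s`.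
[cite: MoeglinVignerasWaldspurger1987, Chap. 2 II.1; Chap. 3 I.1] -/
theorem omega_lineTransportSection :
    (MpPsi.toRep (localSchrodinger F N TV v)).comp (lineTransportSection F E c N hcδ hδ hd TV hV JV hJV a v s' hs') =
      (show Representation ℂ (localPi E c N JV v) (SchwartzBruhat (Fin N → v.adicCompletion F)) from
        ((MpPsi.toRep (localSchrodinger F N (gram F (Equiv.prodUnique (Fin N) (Fin 1)) TV (TW F a)) v)).comp s').comp
          (localLineInl E c N (Equiv.prodUnique (Fin N) (Fin 1)) JV (JW F E a) v)) :=
  MonoidHom.ext fun g => by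
    change MpPsi.toRep _ (lineTransportSection F E c N hcδ hδ hd TV hV JV hJV a v s' hs' g) =
      MpPsi.toRep _ (s' (localLineInl E c N (Equiv.prodUnique (Fin N) (Fin 1)) JV (JW F E a) v g))
    exact toRep_lineTransportSection F E c N hcδ hδ hd TV hV JV hJV a v s' hs' g

/-- the same for a `FinLocalSplittings` family `𝓢` of the pair `(J_V, (a))` (the shape of `localIndexedFamilyAtV`):
`ω_s = (𝓢.omegaLoc v).comp localLineInl`. [cite: GelbartRogawski1991, §3.1 Prop. 3.1.1 p. 455] -/
theorem omega_lineTransportSection_finLocalSplittings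
    (𝓢 : FinLocalSplittings F E c N hcδ hδ hd (gram F (Equiv.prodUnique (Fin N) (Fin 1)) TV (TW F a))
      (isSymm_gram F (Equiv.prodUnique (Fin N) (Fin 1)) hV (isSymm_TW F a))
      (reindex_kronecker_eq_gram_map F E (Equiv.prodUnique (Fin N) (Fin 1)) hJV (JW_eq F E a))) :
    (MpPsi.toRep (localSchrodinger F N TV v)).comp
        (lineTransportSection F E c N hcδ hδ hd TV hV JV hJV a v (𝓢.s v) (𝓢.proj_s v)) =
      (show Representation ℂ (localPi E c N JV v) (SchwartzBruhat (Fin N → v.adicCompletion F)) from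
        (𝓢.omegaLoc v).comp (localLineInl E c N (Equiv.prodUnique (Fin N) (Fin 1)) JV (JW F E a) v)) :=
  omega_lineTransportSection F E c N hcδ hδ hd TV hV JV hJV a v (𝓢.s v) (𝓢.proj_s v)

omit [Algebra.IsQuadraticExtension F E] in
/-- `k ↦ k ⊗ 1 : U(J_V)(F_v) → U(J_V ⊗ J_W)(F_v)` is continuous. [cite: MoeglinVignerasWaldspurger1987, Ch. 1 I.17] -/
theorem continuous_localLineInl {n : ℕ} (e : Fin N × Fin 1 ≃ Fin n) (JW' : Matrix (Fin 1) (Fin 1) E) :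
    Continuous (localLineInl E c N e JV JW' v) :=
  Continuous.subtype_mk (continuous_pi fun w => (UnitaryGroup.continuous_reindexGL e).comp
    (continuous_kroneckerGL.comp ((((continuous_apply w).comp continuous_subtype_val).prodMk continuous_const)))) _

/-- **smoothness transfers**: `ω_s` is smooth when `ω_{s′}` is (`k ↦ k ⊗ 1` is continuous).
[cite: BernsteinZelevinsky1976, Definition 2.1] -/
theorem isSmooth_lineTransportSection
    (hsm : Representation.IsSmooth
      ((MpPsi.toRep (localSchrodinger F N (gram F (Equiv.prodUnique (Fin N) (Fin 1)) TV (TW F a)) v)).comp s')) :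
    Representation.IsSmooth ((MpPsi.toRep (localSchrodinger F N TV v)).comp
      (lineTransportSection F E c N hcδ hδ hd TV hV JV hJV a v s' hs')) := by
  rw [omega_lineTransportSection]
  exact fun Φ => (hsm Φ).preimage (continuous_localLineInl F E c N JV v (Equiv.prodUnique (Fin N) (Fin 1)) (JW F E a))

/-- `ω_s ∘ (centre of U(J_V)) = ω_{s′} ∘ (centre of U(J_V ⊗ (a)))` for any presentation `J₁` of the centre `E_v¹`
(tree `localLineInl_localCenter`). [cite: Mok2014, §1 Notation p. 5] -/
theorem omega_lineTransportSection_comp_localCenter (J₁ : Matrix (Fin 1) (Fin 1) E) (hJ₁ : J₁ 0 0 ≠ 0) :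
    (show Representation ℂ (localPi E c 1 J₁ v) (SchwartzBruhat (Fin N → v.adicCompletion F)) from
        ((MpPsi.toRep (localSchrodinger F N TV v)).comp (lineTransportSection F E c N hcδ hδ hd TV hV JV hJV a v s' hs')).comp
          (localCenter E c N JV J₁ hJ₁ v)) =
      (show Representation ℂ (localPi E c 1 J₁ v) (SchwartzBruhat (Fin N → v.adicCompletion F)) from
        ((MpPsi.toRep (localSchrodinger F N (gram F (Equiv.prodUnique (Fin N) (Fin 1)) TV (TW F a)) v)).comp s').comp
          (localCenter E c N (Matrix.reindex (Equiv.prodUnique (Fin N) (Fin 1)) (Equiv.prodUnique (Fin N) (Fin 1)) (JV ⊗ₖ JW F E a))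
            J₁ hJ₁ v)) :=
  MonoidHom.ext fun z => by
    change MpPsi.toRep _ (lineTransportSection F E c N hcδ hδ hd TV hV JV hJV a v s' hs' (localCenter E c N JV J₁ hJ₁ v z)) =
      MpPsi.toRep _ (s' (localCenter E c N (Matrix.reindex (Equiv.prodUnique (Fin N) (Fin 1)) (Equiv.prodUnique (Fin N) (Fin 1))
        (JV ⊗ₖ JW F E a)) J₁ hJ₁ v z))
    rw [← localLineInl_localCenter]
    exact toRep_lineTransportSection F E c N hcδ hδ hd TV hV JV hJV a v s' hs' (localCenter E c N JV J₁ hJ₁ v z)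

/-- **THE MODEL TRANSPORT, packaged** (slot `stub_modelTransport` of a4-liuD3): for every section `s′` of the pair model
`(a•T_V, δ)` at the reindexing `Equiv.prodUnique` — e.g. `s′ = (𝓢Of t).s v` of `HypD3`'s family member `t` with `aOf t = a` —
there is a section `s` over `ι^{T_V}_{δ/a}` into the COMMON metaplectic group `LocalMp F N T_V v` with
`ω_s = ω_{s′} ∘ (k ↦ k ⊗ 1)` (equality of representations of `U(J_V)(F_v)` on `𝒮(F_vᴺ)`) and `ω_s` smooth if `ω_{s′}` is.
[cite: MoeglinVignerasWaldspurger1987, Chap. 2 II.1; Chap. 3 I.1; Liu2021, App. D §D.1 Steps 1–2] -/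
theorem exists_lineTransportSection
    (hs' : ∀ g, MpPsi.proj _ (s' g) = iota F E c N hcδ hδ hd (gram F (Equiv.prodUnique (Fin N) (Fin 1)) TV (TW F a))
      (isSymm_gram F (Equiv.prodUnique (Fin N) (Fin 1)) hV (isSymm_TW F a))
      (reindex_kronecker_eq_gram_map F E (Equiv.prodUnique (Fin N) (Fin 1)) hJV (JW_eq F E a)) v g) :
    ∃ s : localPi E c N JV v →* LocalMp F N TV v,
      (∀ g, MpPsi.proj _ (s g) = iota F E c N (conj_lineDelta hcδ a) (lineDelta_ne_zero hδ a) (lineDelta_mul_self hd a) TV hV hJV v g) ∧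
      (MpPsi.toRep (localSchrodinger F N TV v)).comp s =
        (show Representation ℂ (localPi E c N JV v) (SchwartzBruhat (Fin N → v.adicCompletion F)) from
          ((MpPsi.toRep (localSchrodinger F N (gram F (Equiv.prodUnique (Fin N) (Fin 1)) TV (TW F a)) v)).comp s').comp
            (localLineInl E c N (Equiv.prodUnique (Fin N) (Fin 1)) JV (JW F E a) v)) ∧
      (Representation.IsSmooth
          ((MpPsi.toRep (localSchrodinger F N (gram F (Equiv.prodUnique (Fin N) (Fin 1)) TV (TW F a)) v)).comp s') →
        Representation.IsSmooth ((MpPsi.toRep (localSchrodinger F N TV v)).comp s)) :=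
  ⟨lineTransportSection F E c N hcδ hδ hd TV hV JV hJV a v s' hs',
    proj_lineTransportSection F E c N hcδ hδ hd TV hV JV hJV a v s' hs',
    omega_lineTransportSection F E c N hcδ hδ hd TV hV JV hJV a v s' hs',
    isSmooth_lineTransportSection F E c N hcδ hδ hd TV hV JV hJV a v s' hs'⟩

end Section

/-! ## §8 Step-1 representatives: `eps (δ/a)` versus the family's `epsLine a = (aδ) ⊗ 1` (they differ by the norm `a²`) -/

section Eps

omit [Algebra.IsQuadraticExtension F E] in
/-- `(a ⊗ 1) · ((δ/a) ⊗ 1) = δ ⊗ 1` in `E_vˣ`. [cite: Liu2021, App. D §D.1 Step 1 (l. 5217)] -/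
theorem unitAt_mul_eps_lineDelta :
    Units.map (toLocalRing E v).toMonoidHom (unitAt F a v) * LemD1OfPlace.eps E v (lineDelta_ne_zero hδ a) =
      LemD1OfPlace.eps E v hδ := by
  apply Units.ext
  change toLocalRing E v (algebraMap F (v.adicCompletion F) (a : F)) *
      algebraMap E (LocalRing E v) (algebraMap F E (↑a⁻¹ : F) * δ) = algebraMap E (LocalRing E v) δ
  rw [map_mul, ← mul_assoc]
  have h1 : toLocalRing E v (algebraMap F (v.adicCompletion F) (a : F)) *
      algebraMap E (LocalRing E v) (algebraMap F E (↑a⁻¹ : F)) = 1 := by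
    rw [← toLocalRing_coe]
    change toLocalRing E v (algebraMap F (v.adicCompletion F) (a : F)) *
      toLocalRing E v (algebraMap F (v.adicCompletion F) (↑a⁻¹ : F)) = 1
    rw [← map_mul, ← map_mul, Units.mul_inv, map_one, map_one]
  rw [h1, one_mul]

omit [Algebra.IsQuadraticExtension F E] in
/-- `epsLine a = (a ⊗ 1) · (δ ⊗ 1)` in `E_vˣ`. [cite: Liu2021, App. D §D.1 Step 1 (l. 5217); Def. 4.12] -/
theorem epsLine_eq :
    epsLine E hδ a v = Units.map (toLocalRing E v).toMonoidHom (unitAt F a v) * LemD1OfPlace.eps E v hδ := by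
  apply Units.ext
  rw [Units.val_mul, Units.coe_map, coe_epsLine, map_mul, ← toLocalRing_coe]
  rfl

omit [Algebra.IsQuadraticExtension F E] in
/-- the scalar `a ⊗ 1 ∈ E_vˣ` is fixed by `c ⊗ 1`. [cite: Liu2021, App. D §D.1 Step 1 (l. 5217)] -/
theorem conjLocal_unitAt :
    Units.map (conjLocal E c v : LocalRing E v →* LocalRing E v) (Units.map (toLocalRing E v).toMonoidHom (unitAt F a v)) =
      Units.map (toLocalRing E v).toMonoidHom (unitAt F a v) :=
  Units.ext (conjLocal_toLocalRing c v _)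

omit [Algebra.IsQuadraticExtension F E] in
/-- **`epsLine a` and `eps (δ/a)` lie in the SAME class, with witness `a ⊗ 1`**: `epsLine a = x · xᶜ · eps (δ/a)` for
`x = a ⊗ 1` (`xᶜ = x`, `x² · (δ/a) = aδ`). [cite: Liu2021, App. D §D.1 Step 1 (l. 5217)] -/
theorem epsLine_eq_mul_conj_mul_eps_lineDelta :
    epsLine E hδ a v =
      Units.map (toLocalRing E v).toMonoidHom (unitAt F a v) *
        Units.map (conjLocal E c v : LocalRing E v →* LocalRing E v) (Units.map (toLocalRing E v).toMonoidHom (unitAt F a v)) *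
          LemD1OfPlace.eps E v (lineDelta_ne_zero hδ a) := by
  rw [conjLocal_unitAt, mul_assoc, unitAt_mul_eps_lineDelta, epsLine_eq]

/-- class bookkeeping in a commutative group: with `σ uᵢ = uᵢ`, `uᵢ εᵢ = ε`, the pairs `(u₁ε, u₂ε)` and `(ε₁, ε₂)` are in
the same `σ`-norm class simultaneously. [folklore] -/
private theorem sameClass_transfer_aux {G : Type*} [CommGroup G] (σ : G →* G) {u₁ u₂ ε ε₁ ε₂ : G}
    (h₁ : σ u₁ = u₁) (h₂ : σ u₂ = u₂) (he₁ : u₁ * ε₁ = ε) (he₂ : u₂ * ε₂ = ε) :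
    (∃ x, u₂ * ε = x * σ x * (u₁ * ε)) ↔ ∃ y, ε₂ = y * σ y * ε₁ := by
  obtain rfl : ε₁ = u₁⁻¹ * ε := eq_inv_mul_of_mul_eq he₁
  obtain rfl : ε₂ = u₂⁻¹ * ε := eq_inv_mul_of_mul_eq he₂
  constructor
  · rintro ⟨x, hx⟩
    have hu₂ : u₂ = x * σ x * u₁ := mul_right_cancel (hx.trans (mul_assoc _ _ _).symm)
    refine ⟨x * u₁ * u₂⁻¹, ?_⟩
    rw [map_mul, map_mul, map_inv, h₁, h₂, hu₂]
    apply Additive.ofMul.injective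
    simp only [ofMul_mul, ofMul_inv]
    abel
  · rintro ⟨y, hy⟩
    have hu : u₂⁻¹ = y * σ y * u₁⁻¹ := mul_right_cancel (hy.trans (mul_assoc _ _ _).symm)
    have hu₂ : u₂ = (y * σ y * u₁⁻¹)⁻¹ := by rw [← hu, inv_inv]
    refine ⟨y * u₂ * u₁⁻¹, ?_⟩
    rw [map_mul, map_mul, map_inv, h₁, h₂, hu₂]
    apply Additive.ofMul.injective
    simp only [ofMul_mul, ofMul_inv]
    abel

omit [Algebra.IsQuadraticExtension F E] in
/-- **The class conditions agree**: for two lines `a₁, a₂ ∈ Fˣ`, the family's representatives `epsLine aᵢ = (aᵢδ) ⊗ 1`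
are in the same class of `E_v^{−×}/Nm E_vˣ` iff the δ-model representatives `eps (δ/aᵢ)` are (each pair differs by the
norm `aᵢ · (aᵢ)ᶜ = aᵢ²`).  So `¬ LemD1.SameClass (eps i) (eps j)` of the family is exactly the hypothesis `_hcls` of
`rankOne_theta_lines_disjoint` at `δᵢ = δ/aᵢ`, `δⱼ = δ/aⱼ`. [cite: Liu2021, App. D §D.1 Step 1 (l. 5217)] -/
theorem sameClass_epsLine_iff_sameClass_eps_lineDelta (a₁ a₂ : Fˣ) :
    (∃ x : (LocalRing E v)ˣ,
        epsLine E hδ a₂ v = x * Units.map (conjLocal E c v : LocalRing E v →* LocalRing E v) x * epsLine E hδ a₁ v) ↔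
      ∃ x : (LocalRing E v)ˣ,
        LemD1OfPlace.eps E v (lineDelta_ne_zero hδ a₂) =
          x * Units.map (conjLocal E c v : LocalRing E v →* LocalRing E v) x * LemD1OfPlace.eps E v (lineDelta_ne_zero hδ a₁) := by
  rw [epsLine_eq F E a₁ v (hδ := hδ), epsLine_eq F E a₂ v (hδ := hδ)]
  exact sameClass_transfer_aux (Units.map (conjLocal E c v : LocalRing E v →* LocalRing E v))
    (conjLocal_unitAt F E c a₁ v) (conjLocal_unitAt F E c a₂ v)
    (unitAt_mul_eps_lineDelta F E a₁ v (hδ := hδ)) (unitAt_mul_eps_lineDelta F E a₂ v (hδ := hδ))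

end Eps

end Literature.NumberTheory.GelbartRogawski1991.UnitaryDualPair.LocalSplitting

end
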